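import Mathlib
import HarnessLib

/-!
# The unique multilinear polynomial of a pseudo-Boolean function (Boros–Hammer, Prop. 2)

Topic `Literature/Combinatorics/Optimization`, companion of `RosenbergQuadratization.lean`,
`TermwiseQuadratization.lean` and `IsingMaxCut.lean`.  Source: E. Boros, P. L. Hammer,
*Pseudo-Boolean optimization*, Discrete Appl. Math. **123** (2002) 155–225 [BorosHammer2002]
(held text `paper:doi-10-1016-s0166-218x-01-00341-9`):

* §2, eq. (1) (chunk p0003 L13–17): “all pseudo-Boolean functions can be uniquely represented as
  multi-linear polynomials, of the form `f(x_1, …, x_n) = Σ_{S ⊆ V} c_S Π_{j∈S} x_j` (1). By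
  convention, we shall always assume that `Π_{j∈∅} x_j = 1`. The size of the largest subset `S ⊆ V`
  for which `c_S ≠ 0` is called the degree of `f`”;
* §4.1, **Proposition 2** (Hammer et al. [87], Hammer and Rudeanu [91]) (chunk p0006 L19–33):
  “Every pseudo-Boolean function `f : Bⁿ → ℝ` has a unique multi-linear polynomial representation
  of form (1).  *Proof.* We need to show that the values of `f` over `Bⁿ` determine uniquely the
  coefficients `c_S`, `S ⊆ V` in (1). Let us show this by induction on the size of these subsets.
  Clearly, `f(0, 0, …, 0) = c_∅` … let `S ⊆ V` be a subset of size `k`. By observing that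
  [`f(𝟙_S) = Σ_{T ⊆ S} c_T` (12)] we obtain [`c_S = f(𝟙_S) − Σ_{T ⊊ S} c_T`]. Since all terms on the
  right-hand side have unique values, in view of (12) the same holds for `c_S`.”

(pub-qadeq lane context — the HUBO / QUBO rows E-42 (certs/E42-quadpenalty: the instance IS its
coefficient table `Q`, `v_ijk`), E-29, E-43, E-45, E-57, E-74 and the application rows whose
‘problem instance’ is a polynomial in 0–1 variables: two codes, or two papers, describe THE SAME
pseudo-Boolean function iff their multilinear coefficient tables agree — this file is the published
statement that makes that comparison well defined.  HONEST FRAMING: instance-level adjudication of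
specific advantage claims; no claim about BQP vs BPP or the summit; nothing here concerns any
solver, device or running time.)

## What is formalised (all proved, 0 named facts)

A point of `Bⁿ = {0,1}^V` is recorded by its support `T ⊆ V` (`x = 𝟙_T`, the paper's notation in
the proof of Prop. 2); `V` is any finite type `ι`, coefficients live in any commutative ring `R`.

* `monomialAt S T` — the value of `Π_{j∈S} x_j` at `x = 𝟙_T` (each factor `1` if `j ∈ T`, else
  `0`); `monomialAt_eq` — it is `1` if `S ⊆ T` and `0` otherwise; `multilinear c T` — the right-hand
  side of (1) at `𝟙_T` for a coefficient family `c : Finset ι → R`;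
  **`multilinear_eq_sum_powerset`** — display (12): `f(𝟙_T) = Σ_{S ⊆ T} c_S`.
* **`multilinear_injective`** — UNIQUENESS (Prop. 2), by the printed induction on `|S|`
  (strong induction over `⊂`): two coefficient families with the same values on `Bⁿ` are equal.
* `coeff f S = Σ_{T ⊆ S} (−1)^{|S|−|T|} f(𝟙_T)` — the coefficients solved from (12) in closed
  form (Möbius inversion over the subset lattice); **`multilinear_coeff`** — EXISTENCE: these
  coefficients represent `f`; `coeff_empty` (“`f(0, …, 0) = c_∅`”);
  **`existsUnique_multilinear`** — Proposition 2 verbatim: every `f : Bⁿ → R` has exactly one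
  multilinear representation; `eq_coeff_of_forall_multilinear_eq` — hence the coefficient table
  of ANY representation is the Möbius transform of the value table.
* Boolean-vector reading: `support x`, `prod_ite_eq_monomialAt` (`Π_{j∈S} [x_j] = monomialAt S
  (support x)`), `multilinear_support` ((1) literally, for `x : ι → Bool`).

Not covered: posiforms and Prop. 1 (min-term representation), the degree, derivatives /
residuals (Prop. 3), and everything from §4.2 on.
-/

namespace Literature.Combinatorics.Optimization

open Finset

namespace PseudoBoolean

variable {ι : Type*} [DecidableEq ι] {R : Type*} [CommRing R]

/-! ### Monomials at 0–1 points -/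

/-- The value of the monomial `Π_{j∈S} x_j` at the 0–1 point `x = 𝟙_T` (characteristic vector of
`T`): each factor is `1` if `j ∈ T` and `0` otherwise.
[cite: BorosHammer2002, §2 eq. (1) (the monomials `Π_{j∈S} x_j`, with `Π_{j∈∅} x_j = 1`)] -/
def monomialAt (S T : Finset ι) : R := ∏ j ∈ S, if j ∈ T then (1 : R) else 0

/-- `Π_{j∈S} x_j` at `𝟙_T` equals `1` if `S ⊆ T` and `0` otherwise — the observation behind (12).
[cite: BorosHammer2002, §4.1 (proof of Prop. 2, display (12))] -/
theorem monomialAt_eq (S T : Finset ι) : (monomialAt S T : R) = if S ⊆ T then 1 else 0 := by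
  unfold monomialAt
  rw [Finset.prod_boole]
  rfl

/-- The empty monomial is `1` (“by convention … `Π_{j∈∅} x_j = 1`”).
[cite: BorosHammer2002, §2 (convention after eq. (1))] -/
theorem monomialAt_empty (T : Finset ι) : (monomialAt ∅ T : R) = 1 := by
  simp [monomialAt]

variable [Fintype ι]

/-- The right-hand side of (1), `Σ_{S ⊆ V} c_S Π_{j∈S} x_j`, evaluated at `x = 𝟙_T`, for a
coefficient family `c`. [cite: BorosHammer2002, §2 eq. (1)] -/
def multilinear (c : Finset ι → R) (T : Finset ι) : R := ∑ S, c S * monomialAt S T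

/-- **Display (12)**: `f(𝟙_T) = Σ_{S ⊆ T} c_S` for a function given by (1).
[cite: BorosHammer2002, §4.1 (proof of Prop. 2, eq. (12))] -/
theorem multilinear_eq_sum_powerset (c : Finset ι → R) (T : Finset ι) :
    multilinear c T = ∑ S ∈ T.powerset, c S := by
  unfold multilinear
  simp_rw [monomialAt_eq, mul_ite, mul_one, mul_zero]
  rw [← Finset.sum_filter]
  refine Finset.sum_congr ?_ fun _ _ => rfl
  ext S
  simp

/-- “Clearly, `f(0, 0, …, 0) = c_∅`”. [cite: BorosHammer2002, §4.1 (proof of Prop. 2)] -/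
theorem multilinear_empty (c : Finset ι → R) : multilinear c ∅ = c ∅ := by
  rw [multilinear_eq_sum_powerset, Finset.powerset_empty, Finset.sum_singleton]

/-! ### Uniqueness (Proposition 2), by the printed induction on `|S|` -/

/-- **Uniqueness of the multilinear representation** (Boros–Hammer Prop. 2, the induction of its
proof): if two coefficient families define the same function on `Bⁿ`, they coincide — from (12),
`c_S = f(𝟙_S) − Σ_{T ⊊ S} c_T` is determined once all `c_T`, `T ⊊ S`, are.
[cite: BorosHammer2002, §4.1 Prop. 2 (uniqueness; proof by induction on |S|)] -/
theorem multilinear_injective {c c' : Finset ι → R}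
    (h : ∀ T : Finset ι, multilinear c T = multilinear c' T) : c = c' := by
  have hd : ∀ T : Finset ι, ∑ S ∈ T.powerset, (c S - c' S) = 0 := by
    intro T
    rw [Finset.sum_sub_distrib, ← multilinear_eq_sum_powerset, ← multilinear_eq_sum_powerset, h T,
      sub_self]
  suffices hz : ∀ S : Finset ι, c S - c' S = 0 by
    funext S
    exact sub_eq_zero.mp (hz S)
  intro S
  induction S using Finset.strongInductionOn with
  | _ S ih =>
    have hsplit : ∑ T ∈ S.powerset, (c T - c' T) =
        ∑ T ∈ S.powerset.erase S, (c T - c' T) + (c S - c' S) :=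
      (Finset.sum_erase_add _ _ (Finset.mem_powerset_self S)).symm
    have hzero : ∑ T ∈ S.powerset.erase S, (c T - c' T) = 0 :=
      Finset.sum_eq_zero fun T hT => by
        obtain ⟨hne, hT'⟩ := Finset.mem_erase.mp hT
        exact ih T (Finset.ssubset_iff_subset_ne.mpr ⟨Finset.mem_powerset.mp hT', hne⟩)
    have hS := hd S
    rwa [hsplit, hzero, zero_add] at hS

/-! ### Existence: the coefficients in closed form (Möbius inversion of (12)) -/

/-- The coefficient table of `f : Bⁿ → R` (values indexed by supports): the solution of the
triangular system (12), `c_S = Σ_{T ⊆ S} (−1)^{|S|−|T|} f(𝟙_T)` (Möbius inversion over the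
subset lattice; the proof of Prop. 2 solves (12) recursively, `c_S = f(𝟙_S) − Σ_{T ⊊ S} c_T`).
[cite: BorosHammer2002, §4.1 Prop. 2 (proof: c_S determined from (12))] -/
def coeff (f : Finset ι → R) (S : Finset ι) : R :=
  ∑ T ∈ S.powerset, (-1) ^ (S.card - T.card) * f T

omit [DecidableEq ι] [Fintype ι] in
/-- `c_∅ = f(0, …, 0)`. [cite: BorosHammer2002, §4.1 (proof of Prop. 2)] -/
theorem coeff_empty (f : Finset ι → R) : coeff f ∅ = f ∅ := by
  simp [coeff]

omit [Fintype ι] in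
/-- The alternating sum over a subset lattice, in the ring `R`: `Σ_{V ⊆ X} (−1)^{|V|} = [X = ∅]`
(plumbing; Mathlib's `Finset.sum_powerset_neg_one_pow_card` cast from `ℤ`). [folklore] -/
private theorem sum_powerset_neg_one_pow_card_cast (X : Finset ι) :
    ∑ V ∈ X.powerset, (-1 : R) ^ V.card = if X = ∅ then 1 else 0 := by
  have h := congrArg (fun z : ℤ => (z : R)) (Finset.sum_powerset_neg_one_pow_card (x := X))
  simp only [Int.cast_sum, Int.cast_pow, Int.cast_neg, Int.cast_one] at h
  rw [h]
  split_ifs <;> simp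

omit [Fintype ι] in
/-- The Möbius step: for `T ⊆ U`, `Σ_{T ⊆ S ⊆ U} (−1)^{|S|−|T|} = [U = T]` (substitute `S = T ∪ V`,
`V ⊆ U ∖ T`) (plumbing). [folklore] -/
private theorem sum_filter_neg_one_pow_card_sub {T U : Finset ι} (hTU : T ⊆ U) :
    ∑ S ∈ U.powerset.filter (fun S => T ⊆ S), (-1 : R) ^ (S.card - T.card) =
      if U = T then 1 else 0 := by
  have key : ∑ S ∈ U.powerset.filter (fun S => T ⊆ S), (-1 : R) ^ (S.card - T.card) =
      ∑ V ∈ (U \ T).powerset, (-1 : R) ^ V.card := by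
    refine Finset.sum_nbij' (fun S => S \ T) (fun V => T ∪ V) ?_ ?_ ?_ ?_ ?_
    · intro S hS
      obtain ⟨hSU, hTS⟩ := Finset.mem_filter.mp hS
      exact Finset.mem_powerset.mpr (Finset.sdiff_subset_sdiff (Finset.mem_powerset.mp hSU) le_rfl)
    · intro V hV
      have hV' : V ⊆ U \ T := Finset.mem_powerset.mp hV
      refine Finset.mem_filter.mpr ⟨Finset.mem_powerset.mpr ?_, Finset.subset_union_left⟩
      exact Finset.union_subset hTU (hV'.trans Finset.sdiff_subset)
    · intro S hS
      obtain ⟨-, hTS⟩ := Finset.mem_filter.mp hS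
      exact Finset.union_sdiff_of_subset hTS
    · intro V hV
      have hV' : V ⊆ U \ T := Finset.mem_powerset.mp hV
      have hdis : Disjoint T V := Finset.disjoint_of_subset_right hV' Finset.disjoint_sdiff
      exact Finset.union_sdiff_cancel_left hdis
    · intro S hS
      obtain ⟨-, hTS⟩ := Finset.mem_filter.mp hS
      rw [Finset.card_sdiff_of_subset hTS]
  rw [key, sum_powerset_neg_one_pow_card_cast]
  by_cases hUT : U = T
  · rw [if_pos hUT, if_pos (by rw [hUT, Finset.sdiff_self])]
  · rw [if_neg hUT, if_neg]
    intro hemp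
    exact hUT (Finset.Subset.antisymm (Finset.sdiff_eq_empty_iff_subset.mp hemp) hTU)

omit [Fintype ι] in
/-- **The Möbius coefficients satisfy (12)**: `Σ_{S ⊆ U} c_S = f(𝟙_U)` for `c = coeff f`.
[cite: BorosHammer2002, §4.1 Prop. 2 (proof: the system (12))] -/
theorem sum_powerset_coeff (f : Finset ι → R) (U : Finset ι) :
    ∑ S ∈ U.powerset, coeff f S = f U := by
  unfold coeff
  rw [Finset.sum_comm' (s' := fun T => U.powerset.filter (fun S => T ⊆ S)) (t' := U.powerset)
    (h := fun S T => by
      simp only [Finset.mem_powerset, Finset.mem_filter]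
      exact ⟨fun ⟨hSU, hTS⟩ => ⟨⟨hSU, hTS⟩, hTS.trans hSU⟩, fun ⟨⟨hSU, hTS⟩, _⟩ => ⟨hSU, hTS⟩⟩)]
  simp_rw [← Finset.sum_mul]
  rw [Finset.sum_congr rfl fun T hT => by
    rw [sum_filter_neg_one_pow_card_sub (Finset.mem_powerset.mp hT)]]
  simp_rw [ite_mul, one_mul, zero_mul]
  rw [Finset.sum_ite_eq, if_pos (Finset.mem_powerset_self U)]

/-- **Existence of the multilinear representation** (Boros–Hammer Prop. 2, existence half): the
coefficients `coeff f` represent `f` — `Σ_S c_S Π_{j∈S} x_j = f(x)` at every `x = 𝟙_T ∈ Bⁿ`.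
[cite: BorosHammer2002, §4.1 Prop. 2 (existence)] -/
theorem multilinear_coeff (f : Finset ι → R) (T : Finset ι) : multilinear (coeff f) T = f T := by
  rw [multilinear_eq_sum_powerset, sum_powerset_coeff]

/-- **Proposition 2 (Hammer et al. [87], Hammer and Rudeanu [91]) verbatim**: every pseudo-Boolean
function `f : Bⁿ → R` has a UNIQUE multilinear polynomial representation of form (1).
[cite: BorosHammer2002, §4.1 Prop. 2] -/
theorem existsUnique_multilinear (f : Finset ι → R) :
    ∃! c : Finset ι → R, ∀ T, multilinear c T = f T :=
  ⟨coeff f, multilinear_coeff f, fun c hc =>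
    multilinear_injective fun T => by rw [hc T, multilinear_coeff]⟩

/-- Consequently the coefficient table of ANY multilinear representation of `f` is the Möbius
transform of its value table. [cite: BorosHammer2002, §4.1 Prop. 2] -/
theorem eq_coeff_of_forall_multilinear_eq {c : Finset ι → R} {f : Finset ι → R}
    (h : ∀ T, multilinear c T = f T) : c = coeff f :=
  multilinear_injective fun T => by rw [h T, multilinear_coeff]

/-! ### Reading (1) on Boolean vectors -/

/-- The support `{j : x_j = 1}` of a Boolean vector (the `T` with `x = 𝟙_T`).
[cite: BorosHammer2002, §4.1 (proof of Prop. 2: the characteristic vectors `𝟙_S`)] -/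
def support (x : ι → Bool) : Finset ι := univ.filter fun j => x j = true

omit [DecidableEq ι] in
/-- `j ∈ support x ↔ x_j = 1`. [cite: BorosHammer2002, §4.1 (characteristic vectors)] -/
@[simp] theorem mem_support (x : ι → Bool) (j : ι) : j ∈ support x ↔ x j = true := by
  simp [support]

/-- On a Boolean vector the monomial `Π_{j∈S} [x_j]` (`[true] = 1`, `[false] = 0`) is
`monomialAt S (support x)`. [cite: BorosHammer2002, §2 eq. (1)] -/
theorem prod_ite_eq_monomialAt (S : Finset ι) (x : ι → Bool) :
    ∏ j ∈ S, (if x j = true then (1 : R) else 0) = monomialAt S (support x) := by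
  unfold monomialAt
  refine Finset.prod_congr rfl fun j _ => ?_
  simp only [mem_support]

/-- Eq. (1) literally, for `x : ι → Bool`: `Σ_{S ⊆ V} c_S Π_{j∈S} [x_j] = multilinear c (support x)`;
with `c = coeff f` this is `f` at the point `x` (`multilinear_coeff`).
[cite: BorosHammer2002, §2 eq. (1)] -/
theorem multilinear_support (c : Finset ι → R) (x : ι → Bool) :
    ∑ S, c S * ∏ j ∈ S, (if x j = true then (1 : R) else 0) = multilinear c (support x) := by
  unfold multilinear
  exact Finset.sum_congr rfl fun S _ => by rw [prod_ite_eq_monomialAt]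

end PseudoBoolean

end Literature.Combinatorics.Optimization
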